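import Literature.NumberTheory.GaloisRepresentations.ContinuousCupProductCompat
import Literature.NumberTheory.GaloisRepresentations.ContinuousCorestriction
import HarnessLib

/-!
# The cup product along a compatible pair, and its compatibility with conjugation

Theorems only (no definition, no named fact, no instance). For the cup product
`H¹ × H¹ → H²` of the tree's `ContinuousCupProduct.lean`:

* `ContPairing.cupCocycle_mapPair`, **`ContPairing.cupProduct_mapPair`** — naturality along a
  COMPATIBLE PAIR `(θ : H → G; α, β, γ)`: if `γ⟨x, y⟩₁ = ⟨α x, β y⟩₂` for module maps
  `α : X₁|_θ → X₂`, `β : Y₁|_θ → Y₂`, `γ : Z₁|_θ → Z₂` over `θ`, then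
  `H²(θ, γ)(a ∪₁ b) = H¹(θ, α) a ∪₂ H¹(θ, β) b` (Neukirch–Schmidt–Wingberg (1.5.3): the common
  generalisation of the tree's `cupProduct_map` (θ = id) and `cupProduct_res` (α = β = γ = id));
* **`ContPairing.cupProduct_conjMap`** — for a normal subgroup `S ⊴ G`, the conjugation action
  `conjMap · S g` (`ContinuousCorestriction.lean`) is multiplicative:
  `g · (a ∪ b) = (g · a) ∪ (g · b)` on `H¹(S, X) × H¹(S, Y) → H²(S, Z)` for the restricted pairing.

The second statement is the Galois-invariance input of pairings built from cup products on open
normal subgroups (e.g. the finite-level local Tate pairings along a `ℤ_p`-tower).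

## References
* J. Neukirch, A. Schmidt, K. Wingberg, *Cohomology of Number Fields* (2008), I §5 Prop. 1.5.3
  (cup product and compatible pairs, conjugation). [NeukirchSchmidtWingberg2008]
* J.-P. Serre, *Galois Cohomology* (1997), I §2.4 (compatible pairs). [SerreGaloisCohomology1997]
-/

noncomputable section

open CategoryTheory Function

universe u v

namespace Literature.NumberTheory.GaloisRepresentations

open _root_.TopRep _root_.ContRepresentation _root_.ContinuousCohomology

namespace ContPairing

/-! ### Naturality along a compatible pair -/

section MapPair

variable {R : Type u} [CommRing R] [TopologicalSpace R]
variable {G : Type v} [Group G] [TopologicalSpace G] [IsTopologicalGroup G] [LocallyCompactSpace G]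
variable {H : Type v} [Group H] [TopologicalSpace H] [IsTopologicalGroup H] [LocallyCompactSpace H]
variable {X₁ Y₁ Z₁ : TopRep.{v} R G} {X₂ Y₂ Z₂ : TopRep.{v} R H}

omit [LocallyCompactSpace G] [LocallyCompactSpace H] in
/-- Naturality of the cup-product cocycle along a compatible pair `(θ; α, β, γ)`:
`γ ∘ (f ∪₁ g) ∘ (θ × θ) = (α ∘ f ∘ θ) ∪₂ (β ∘ g ∘ θ)`. [cite: NeukirchSchmidtWingberg2008, I §5 Prop. 1.5.3] -/
theorem cupCocycle_mapPair (P₁ : ContPairing X₁ Y₁ Z₁) (P₂ : ContPairing X₂ Y₂ Z₂) (θ : H →ₜ* G)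
    (α : TopRep.res (θ : H →* G) X₁ ⟶ X₂) (β : TopRep.res (θ : H →* G) Y₁ ⟶ Y₂)
    (γ : TopRep.res (θ : H →* G) Z₁ ⟶ Z₂)
    (hc : ∀ x y, γ.hom (P₁.toLin x y) = P₂.toLin (α.hom x) (β.hom y))
    (f : contOneCocycles X₁) (g : contOneCocycles Y₁) :
    contTwoCocycles.pullback θ γ (P₁.cupCocycle f g) =
      P₂.cupCocycle (contOneCocycles.pullback θ α f) (contOneCocycles.pullback θ β g) := by
  refine Subtype.ext (ContinuousMap.ext fun p => ?_)
  obtain ⟨σ, τ⟩ := p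
  rw [contTwoCocycles.pullback_apply, cupCocycle_apply, cupCocycle_apply, hc,
    contOneCocycles.pullback_apply, contOneCocycles.pullback_apply,
    contOneCocycles.pullback_apply, _root_.map_mul θ, map_sub]

/-- **Naturality of the cup product along a compatible pair**: if `γ⟨x, y⟩₁ = ⟨α x, β y⟩₂` then
`H²(θ, γ)(a ∪₁ b) = H¹(θ, α) a ∪₂ H¹(θ, β) b`. [cite: NeukirchSchmidtWingberg2008, I §5 Prop. 1.5.3] -/
theorem cupProduct_mapPair (P₁ : ContPairing X₁ Y₁ Z₁) (P₂ : ContPairing X₂ Y₂ Z₂) (θ : H →ₜ* G)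
    (α : TopRep.res (θ : H →* G) X₁ ⟶ X₂) (β : TopRep.res (θ : H →* G) Y₁ ⟶ Y₂)
    (γ : TopRep.res (θ : H →* G) Z₁ ⟶ Z₂)
    (hc : ∀ x y, γ.hom (P₁.toLin x y) = P₂.toLin (α.hom x) (β.hom y))
    (a : continuousCohomology 1 X₁) (b : continuousCohomology 1 Y₁) :
    ContinuousCohomology.map θ γ 2 (P₁.cupProduct a b) =
      P₂.cupProduct (ContinuousCohomology.map θ α 1 a) (ContinuousCohomology.map θ β 1 b) := by
  obtain ⟨f, rfl⟩ := oneCocycleClass_surjective _ a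
  obtain ⟨g, rfl⟩ := oneCocycleClass_surjective _ b
  rw [cupProduct_oneCocycleClass_eq_twoCocycleClass, map_twoCocycleClass,
    cupCocycle_mapPair P₁ P₂ θ α β γ hc, map_oneCocycleClass, map_oneCocycleClass,
    cupProduct_oneCocycleClass_eq_twoCocycleClass]

end MapPair

/-! ### Compatibility with the conjugation action of a normal subgroup -/

section Conj

variable {R : Type u} [CommRing R] [TopologicalSpace R]
variable {G : Type v} [Group G] [TopologicalSpace G] [IsTopologicalGroup G]
variable {X Y Z : TopRep.{v} R G} (P : ContPairing X Y Z) (S : Subgroup G) [S.Normal]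
  [LocallyCompactSpace S]

/-- **`g · (a ∪ b) = (g · a) ∪ (g · b)`**: the conjugation action of `g ∈ G` on the cohomology of a
normal subgroup `S` (`conjMap`, the compatible pair `(x ↦ g⁻¹ x g, v ↦ g v)`) is multiplicative for
the cup product of the restricted pairing `X|_S × Y|_S → Z|_S` (equivariance `g⟨x, y⟩ = ⟨g x, g y⟩`).
[cite: NeukirchSchmidtWingberg2008, I §5 Prop. 1.5.3] -/
theorem cupProduct_conjMap (g : G) (a : continuousCohomology 1 (subgroupRep X S))
    (b : continuousCohomology 1 (subgroupRep Y S)) :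
    conjMap Z S g 2 ((P.restrict (subgroupIncl S)).cupProduct a b) =
      (P.restrict (subgroupIncl S)).cupProduct (conjMap X S g 1 a) (conjMap Y S g 1 b) :=
  cupProduct_mapPair (P.restrict (subgroupIncl S)) (P.restrict (subgroupIncl S))
    (Literature.NumberTheory.EllipticCurves.subgroupConj S g) (conjRepHom X S g) (conjRepHom Y S g)
    (conjRepHom Z S g) (fun x y => (P.toLin_smul g x y).symm) a b

end Conj

end ContPairing

end Literature.NumberTheory.GaloisRepresentations
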